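import Mathlib
import HarnessLib
import Summits.NavierStokesRegularity.NavierStokesRegularity.Theorems.PoloidalWindowRigidity.Negative.StuartColumn

/-!
# Crux K2 `PoloidalWindowRigidity` (stmt-NavierStokesRegularity-19708), skeleton lrc-jet v4 — negative side, brick 2/3:
# the Stuart column's vorticity gradient, real-analyticity, window and pins (thick stratum)

Negative-side support (refuter seat ns-regularity-refuter1, cell ns-regularity-ideate; D-0081 §C), continuing
`…Negative.StuartColumn` (the frozen poloidal Type-I profile `v(t, x) = (−t)^{-1/2} V(x)`,
`V = (cos x₂ (e^{x₀} − e^{−x₀})/W, −cos x₂ sin x₁/W, −3 sin x₂/W²)`, `W = e^{x₀} + e^{−x₀} + cos x₁`). Certified here: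
* `hasFDerivAt_stuartVort` / `fderiv_curl_stuartProfile_apply`: the derivative of the vorticity
  `curl v(t) = −(−t)^{-1/2} sin x₂ (W⁻¹ + 6 W⁻³)(sin x₁, e^{x₀} − e^{−x₀}, 0)` in closed form;
* `analyticOnNhd_stuartProfile`, `analyticOnNhd_curl_stuartProfile`, `analyticOnNhd_fderiv_curl_stuartProfile_apply`:
  every slice, its vorticity and the directional derivatives of the vorticity are real-analytic on `ℝ³`;
* `stuartProfile_pins`: on the window `stuartWindow = {t < 0} × {x₀ > 0, 0 < x₂ < π}` the three non-degeneracy pins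
  of the K2 skeleton hold (`curl v ≠ 0`, `∂₀ v₂ ≠ 0`, `∂₂ v₀ ≠ 0`);
* `stuartProfile_slope_not_timeHeight`: **the thick-stratum pin of `stub_lrcGeneric`** — for every candidate slope
  `m : ℝ → ℝ → ℝ` of time and height and every non-empty open `W₁ ⊆ stuartWindow` some point of `W₁` has
  `∂₂ v₀ ≠ m(t, x₂) ∂₀ v₂`: the Clebsch slope `−W(x₀, x₁)²/6` strictly decreases along `x₀` (`Real.cosh_lt_cosh`), so it
  is a function of `(t, x₂)` on no open set — the witness lies in the THICK stratum of the K2 lead's census.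

WHAT THIS IS NOT: not a claim about Navier–Stokes regularity — explicit vector calculus for a kinematic witness.
-/

noncomputable section

-- the summit and its single sub-problem share the name (CONVENTIONS §1), as in every Theorems file
set_option linter.dupNamespace false

namespace Summit.NavierStokesRegularity.NavierStokesRegularity.Theorems.PoloidalWindowRigidity.Negative

open MeasureTheory Set Function Filter Topology Metric
open scoped RealInnerProductSpace InnerProductSpace
open Literature.Analysis Literature.Analysis.FluidPDE

local notation "E3" => EuclideanSpace ℝ (Fin 3)
local notation "π" i => (EuclideanSpace.proj (𝕜 := ℝ) (i : Fin 3) : EuclideanSpace ℝ (Fin 3) →L[ℝ] ℝ)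
local notation "𝐞" i => (EuclideanSpace.single (i : Fin 3) (1 : ℝ) : EuclideanSpace ℝ (Fin 3))

/-! ## The derivative of the vorticity -/

/-- The derivative of the vorticity pattern in closed form: with `P = e^{x₀} − e^{−x₀}`, `Q = e^{x₀} + e^{−x₀}`,
`r = W⁻¹`, `G = r + 6 r³`, `K = r² + 18 r⁴` (`dG = −K dW`), the Jacobian `(∂ⱼΩᵢ)` is
`((sin x₂ sin x₁ P K, −sin x₂ cos x₁ G − sin x₂ sin² x₁ K, −cos x₂ sin x₁ G),
(−sin x₂ Q G + sin x₂ P² K, −sin x₂ P sin x₁ K, −cos x₂ P G), 0)`. [folklore] -/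
def stuartVortDeriv (x : E3) : E3 →L[ℝ] E3 :=
  ((Real.sin (x 2) * Real.sin (x 1) * (Real.exp (x 0) - Real.exp (-(x 0))) *
          ((stuartW x)⁻¹ ^ 2 + 18 * (stuartW x)⁻¹ ^ 4)) • (π 0) +
        (-(Real.sin (x 2) * Real.cos (x 1) * ((stuartW x)⁻¹ + 6 * (stuartW x)⁻¹ ^ 3)) -
          Real.sin (x 2) * Real.sin (x 1) ^ 2 * ((stuartW x)⁻¹ ^ 2 + 18 * (stuartW x)⁻¹ ^ 4)) • (π 1) +
        (-(Real.cos (x 2) * Real.sin (x 1) * ((stuartW x)⁻¹ + 6 * (stuartW x)⁻¹ ^ 3))) • (π 2)).smulRight (𝐞 0) +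
    ((-(Real.sin (x 2) * (Real.exp (x 0) + Real.exp (-(x 0))) * ((stuartW x)⁻¹ + 6 * (stuartW x)⁻¹ ^ 3)) +
          Real.sin (x 2) * (Real.exp (x 0) - Real.exp (-(x 0))) ^ 2 *
            ((stuartW x)⁻¹ ^ 2 + 18 * (stuartW x)⁻¹ ^ 4)) • (π 0) +
        (-(Real.sin (x 2) * (Real.exp (x 0) - Real.exp (-(x 0))) * Real.sin (x 1) *
          ((stuartW x)⁻¹ ^ 2 + 18 * (stuartW x)⁻¹ ^ 4))) • (π 1) +
        (-(Real.cos (x 2) * (Real.exp (x 0) - Real.exp (-(x 0))) *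
          ((stuartW x)⁻¹ + 6 * (stuartW x)⁻¹ ^ 3))) • (π 2)).smulRight (𝐞 1)

/-- The components of `DΩ(x) w`. [folklore] -/
theorem stuartVortDeriv_apply_zero (x w : E3) : stuartVortDeriv x w 0 =
    Real.sin (x 2) * Real.sin (x 1) * (Real.exp (x 0) - Real.exp (-(x 0))) *
          ((stuartW x)⁻¹ ^ 2 + 18 * (stuartW x)⁻¹ ^ 4) * w 0 +
      (-(Real.sin (x 2) * Real.cos (x 1) * ((stuartW x)⁻¹ + 6 * (stuartW x)⁻¹ ^ 3)) -
          Real.sin (x 2) * Real.sin (x 1) ^ 2 * ((stuartW x)⁻¹ ^ 2 + 18 * (stuartW x)⁻¹ ^ 4)) * w 1 +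
      -(Real.cos (x 2) * Real.sin (x 1) * ((stuartW x)⁻¹ + 6 * (stuartW x)⁻¹ ^ 3)) * w 2 := by
  simp [stuartVortDeriv]

/-- The second component of `DΩ(x) w`. [folklore] -/
theorem stuartVortDeriv_apply_one (x w : E3) : stuartVortDeriv x w 1 =
    (-(Real.sin (x 2) * (Real.exp (x 0) + Real.exp (-(x 0))) * ((stuartW x)⁻¹ + 6 * (stuartW x)⁻¹ ^ 3)) +
          Real.sin (x 2) * (Real.exp (x 0) - Real.exp (-(x 0))) ^ 2 *
            ((stuartW x)⁻¹ ^ 2 + 18 * (stuartW x)⁻¹ ^ 4)) * w 0 +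
      -(Real.sin (x 2) * (Real.exp (x 0) - Real.exp (-(x 0))) * Real.sin (x 1) *
          ((stuartW x)⁻¹ ^ 2 + 18 * (stuartW x)⁻¹ ^ 4)) * w 1 +
      -(Real.cos (x 2) * (Real.exp (x 0) - Real.exp (-(x 0))) * ((stuartW x)⁻¹ + 6 * (stuartW x)⁻¹ ^ 3)) * w 2 := by
  simp [stuartVortDeriv]

/-- The third component of `DΩ(x) w` vanishes. [folklore] -/
theorem stuartVortDeriv_apply_two (x w : E3) : stuartVortDeriv x w 2 = 0 := by
  simp [stuartVortDeriv]

/-- `Ω` is differentiable with derivative `stuartVortDeriv`. [folklore] -/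
theorem hasFDerivAt_stuartVort (x : E3) : HasFDerivAt stuartVort (stuartVortDeriv x) x := by
  have h0 : HasFDerivAt (fun y : E3 => y 0) (π 0) x := (π 0).hasFDerivAt
  have h1 : HasFDerivAt (fun y : E3 => y 1) (π 1) x := (π 1).hasFDerivAt
  have h2 : HasFDerivAt (fun y : E3 => y 2) (π 2) x := (π 2).hasFDerivAt
  have hE := (Real.hasDerivAt_exp (x 0)).comp_hasFDerivAt x h0
  have hE' := (Real.hasDerivAt_exp (-(x 0))).comp_hasFDerivAt x h0.neg
  have hs1 := (Real.hasDerivAt_sin (x 1)).comp_hasFDerivAt x h1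
  have hs2 := (Real.hasDerivAt_sin (x 2)).comp_hasFDerivAt x h2
  have hr : HasFDerivAt (fun y : E3 => (stuartW y)⁻¹)
      ((-(stuartW x ^ 2)⁻¹) • (Real.exp (x 0) • (π 0) + Real.exp (-(x 0)) • (-(π 0)) +
        (-(Real.sin (x 1))) • (π 1))) x :=
    (hasDerivAt_inv (stuartW_ne_zero x)).comp_hasFDerivAt x (hasFDerivAt_stuartW x)
  have hG := hr.add ((hr.pow 3).const_mul (6 : ℝ))
  have hΩ0 := ((hs2.mul hs1).mul hG).neg.smul_const (𝐞 0)
  have hΩ1 := ((hs2.mul (hE.sub hE')).mul hG).neg.smul_const (𝐞 1)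
  have H : HasFDerivAt stuartVort _ x := hΩ0.add hΩ1
  refine H.congr_fderiv ?_
  have hW := stuartW_ne_zero x
  ext w i
  fin_cases i
  · simp [stuartVortDeriv]
    field_simp
    ring
  · simp [stuartVortDeriv]
    field_simp
    ring
  · simp [stuartVortDeriv]

/-- `D(curl v(t)) = (−t)^{-1/2} DΩ`. [folklore] -/
theorem hasFDerivAt_curl_stuartProfile (t : ℝ) (x : E3) :
    HasFDerivAt (curl (stuartProfile t)) (cellAmp t • stuartVortDeriv x) x := by
  rw [curl_stuartProfile_eq]
  exact (hasFDerivAt_stuartVort x).const_smul (cellAmp t)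

/-- `D(curl v(t))(x) w` in coordinates. [folklore] -/
theorem fderiv_curl_stuartProfile_apply (t : ℝ) (x w : E3) (i : Fin 3) :
    fderiv ℝ (curl (stuartProfile t)) x w i = cellAmp t * stuartVortDeriv x w i := by
  rw [(hasFDerivAt_curl_stuartProfile t x).fderiv]; rfl

/-! ## Real-analyticity of the slices and of the vorticity -/

/-- `W` is real-analytic. [folklore] -/
theorem analyticAt_stuartW (x : E3) : AnalyticAt ℝ stuartW x :=
  ((analyticAt_rexp.comp ((π 0).analyticAt x)).add (analyticAt_rexp.comp ((π 0).analyticAt x).neg)).add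
    (Real.analyticAt_cos.comp ((π 1).analyticAt x))

/-- `W⁻¹` is real-analytic. [folklore] -/
theorem analyticAt_stuartW_inv (x : E3) : AnalyticAt ℝ (fun y : E3 => (stuartW y)⁻¹) x :=
  (analyticAt_stuartW x).fun_inv (stuartW_ne_zero x)

/-- **Every slice of the profile is real-analytic on `ℝ³`.** [folklore] -/
theorem analyticOnNhd_stuartProfile (s : ℝ) : AnalyticOnNhd ℝ (stuartProfile s) univ := by
  intro x _
  have hY : ∀ k : Fin 3, AnalyticAt ℝ (fun y : E3 => y k) x := fun k => (π k).analyticAt x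
  have hr := analyticAt_stuartW_inv x
  have hP : AnalyticAt ℝ (fun y : E3 => Real.exp (y 0) - Real.exp (-(y 0))) x :=
    (analyticAt_rexp.comp (hY 0)).sub (analyticAt_rexp.comp (hY 0).neg)
  show AnalyticAt ℝ (fun y => cellAmp s • stuartField y) x
  refine (analyticAt_const : AnalyticAt ℝ (fun _ : E3 => cellAmp s) x).smul ?_
  show AnalyticAt ℝ stuartField x
  unfold stuartField
  refine (((((Real.analyticAt_cos.comp (hY 2)).mul hP).mul hr).smul analyticAt_const).add
    ((((Real.analyticAt_cos.comp (hY 2)).mul (Real.analyticAt_sin.comp (hY 1))).mul hr).neg.smul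
      analyticAt_const)).add ?_
  exact ((analyticAt_const.mul (Real.analyticAt_sin.comp (hY 2))).mul (hr.mul hr)).neg.smul analyticAt_const

/-- **The vorticity of every slice is real-analytic on `ℝ³`.** [folklore] -/
theorem analyticOnNhd_curl_stuartProfile (s : ℝ) : AnalyticOnNhd ℝ (curl (stuartProfile s)) univ := by
  intro x _
  have hY : ∀ k : Fin 3, AnalyticAt ℝ (fun y : E3 => y k) x := fun k => (π k).analyticAt x
  have hr := analyticAt_stuartW_inv x
  have hG : AnalyticAt ℝ (fun y : E3 => (stuartW y)⁻¹ + 6 * (stuartW y)⁻¹ ^ 3) x :=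
    hr.add (analyticAt_const.mul (hr.pow 3))
  have hP : AnalyticAt ℝ (fun y : E3 => Real.exp (y 0) - Real.exp (-(y 0))) x :=
    (analyticAt_rexp.comp (hY 0)).sub (analyticAt_rexp.comp (hY 0).neg)
  rw [curl_stuartProfile_eq]
  refine (analyticAt_const : AnalyticAt ℝ (fun _ : E3 => cellAmp s) x).smul ?_
  show AnalyticAt ℝ stuartVort x
  unfold stuartVort
  refine ((((Real.analyticAt_sin.comp (hY 2)).mul (Real.analyticAt_sin.comp (hY 1))).mul hG).neg.smul
    analyticAt_const).add ?_
  exact (((Real.analyticAt_sin.comp (hY 2)).mul hP).mul hG).neg.smul analyticAt_const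

/-- **Every directional derivative of the vorticity of every slice is real-analytic on `ℝ³`.** [folklore] -/
theorem analyticOnNhd_fderiv_curl_stuartProfile_apply (s : ℝ) (e : E3) :
    AnalyticOnNhd ℝ (fun y => fderiv ℝ (curl (stuartProfile s)) y e) univ :=
  (ContinuousLinearMap.apply ℝ (EuclideanSpace ℝ (Fin 3)) e).comp_analyticOnNhd
    (analyticOnNhd_curl_stuartProfile s).fderiv

/-! ## The window, the pins and the thick-stratum pin -/

/-- The space–time window `{t < 0} × {x | x₀ > 0, 0 < x₂ < π}`. [folklore] -/
def stuartWindow : Set (ℝ × E3) :=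
  Set.Iio (0 : ℝ) ×ˢ {x : E3 | 0 < x 0 ∧ 0 < x 2 ∧ x 2 < Real.pi}

/-- The window is open. [folklore] -/
theorem isOpen_stuartWindow : IsOpen stuartWindow := by
  refine isOpen_Iio.prod ?_
  have h0 : Continuous fun x : E3 => x 0 := by fun_prop
  have h2 : Continuous fun x : E3 => x 2 := by fun_prop
  exact (isOpen_lt continuous_const h0).inter ((isOpen_lt continuous_const h2).inter (isOpen_lt h2 continuous_const))

/-- The window is non-empty: it contains `(−1, (1, 0, π/2))`. [folklore] -/
theorem stuartWindow_nonempty : stuartWindow.Nonempty := by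
  refine ⟨((-1 : ℝ), (1 : ℝ) • (𝐞 0) + (Real.pi / 2) • (𝐞 2)), ?_, ?_⟩
  · show (-1 : ℝ) < 0
    norm_num
  · show 0 < ((1 : ℝ) • (𝐞 0) + (Real.pi / 2) • (𝐞 2) : E3) 0 ∧ 0 < ((1 : ℝ) • (𝐞 0) + (Real.pi / 2) • (𝐞 2) : E3) 2 ∧
      ((1 : ℝ) • (𝐞 0) + (Real.pi / 2) • (𝐞 2) : E3) 2 < Real.pi
    have a0 : ((1 : ℝ) • (𝐞 0) + (Real.pi / 2) • (𝐞 2) : E3) 0 = 1 := by simp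
    have a2 : ((1 : ℝ) • (𝐞 0) + (Real.pi / 2) • (𝐞 2) : E3) 2 = Real.pi / 2 := by simp
    rw [a0, a2]
    refine ⟨one_pos, ?_, ?_⟩ <;> linarith [Real.pi_pos]

/-- The window lies in the open backward slab. [folklore] -/
theorem stuartWindow_subset : stuartWindow ⊆ Set.Iio (0 : ℝ) ×ˢ Set.univ :=
  Set.prod_mono le_rfl (Set.subset_univ _)

/-- Membership in the window, unfolded. [folklore] -/
theorem mem_stuartWindow {z : ℝ × E3} (hz : z ∈ stuartWindow) :
    z.1 < 0 ∧ 0 < z.2 0 ∧ 0 < z.2 2 ∧ z.2 2 < Real.pi := by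
  simpa [stuartWindow, Set.mem_prod] using hz

/-- `e^{a} − e^{−a} > 0` for `a > 0`. [folklore] -/
theorem exp_sub_exp_neg_pos {a : ℝ} (ha : 0 < a) : 0 < Real.exp a - Real.exp (-a) :=
  sub_pos.2 (Real.exp_lt_exp.2 (by linarith))

/-- `G = W⁻¹ + 6 W⁻³ > 0`. [folklore] -/
theorem stuartG_pos (x : E3) : 0 < (stuartW x)⁻¹ + 6 * (stuartW x)⁻¹ ^ 3 := by
  have := inv_pos.2 (stuartW_pos x)
  positivity

/-- **The three non-degeneracy pins hold on the window**: `curl v ≠ 0`, `∂₀ v₂ ≠ 0`, `∂₂ v₀ ≠ 0`. [folklore] -/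
theorem stuartProfile_pins (z : ℝ × E3) (hz : z ∈ stuartWindow) :
    curl (stuartProfile z.1) z.2 ≠ 0 ∧
      (fderiv ℝ (stuartProfile z.1) z.2 (𝐞 0) 2 ≠ 0 ∨ fderiv ℝ (stuartProfile z.1) z.2 (𝐞 1) 2 ≠ 0) ∧
      (fderiv ℝ (stuartProfile z.1) z.2 (𝐞 2) 0 ≠ 0 ∨ fderiv ℝ (stuartProfile z.1) z.2 (𝐞 2) 1 ≠ 0) := by
  obtain ⟨ht, hx0, hx2, hx2'⟩ := mem_stuartWindow hz
  have hc := cellAmp_pos ht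
  have hsin : 0 < Real.sin (z.2 2) := Real.sin_pos_of_pos_of_lt_pi hx2 hx2'
  have hP := exp_sub_exp_neg_pos hx0
  have hr : 0 < (stuartW z.2)⁻¹ := inv_pos.2 (stuartW_pos z.2)
  have hG := stuartG_pos z.2
  refine ⟨fun h0 => ?_, Or.inl ?_, Or.inl ?_⟩
  · have h1 := curl_stuartProfile_apply_one z.1 z.2
    rw [h0, PiLp.zero_apply] at h1
    have : 0 < cellAmp z.1 * (Real.sin (z.2 2) * (Real.exp (z.2 0) - Real.exp (-(z.2 0))) *
        ((stuartW z.2)⁻¹ + 6 * (stuartW z.2)⁻¹ ^ 3)) := mul_pos hc (mul_pos (mul_pos hsin hP) hG)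
    linarith
  · rw [fderiv_stuartProfile_e0_apply_two]
    exact (mul_pos hc (mul_pos (mul_pos (mul_pos (by norm_num) hsin) hP) (pow_pos hr 3))).ne'
  · rw [fderiv_stuartProfile_e2_apply_zero]
    have : 0 < cellAmp z.1 * (Real.sin (z.2 2) * (Real.exp (z.2 0) - Real.exp (-(z.2 0))) * (stuartW z.2)⁻¹) :=
      mul_pos hc (mul_pos (mul_pos hsin hP) hr)
    intro h
    linarith

/-- **The thick-stratum pin holds on the window**: for every candidate slope `m : ℝ → ℝ → ℝ` depending on time and
height only and every non-empty open `W₁ ⊆ stuartWindow`, some point of `W₁` has `∂₂ v₀ ≠ m(t, x₂) ∂₀ v₂` — because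
`∂₂ v₀ / ∂₀ v₂ = −W(x₀, x₁)²/6` strictly decreases along the horizontal segment `x₀ ↦ x₀ + δ` inside `W₁`, on which
`m(t, x₂)` is constant. [folklore] -/
theorem stuartProfile_slope_not_timeHeight (m : ℝ → ℝ → ℝ) (W₁ : Set (ℝ × E3)) (hW₁ : W₁ ⊆ stuartWindow)
    (hW₁o : IsOpen W₁) (hW₁n : W₁.Nonempty) :
    ∃ z ∈ W₁, ∃ b : Fin 3, b ≠ 2 ∧
      fderiv ℝ (stuartProfile z.1) z.2 (𝐞 2) b ≠ m z.1 (z.2 2) * fderiv ℝ (stuartProfile z.1) z.2 (𝐞 b) 2 := by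
  by_contra hcon
  push Not at hcon
  obtain ⟨z, hz⟩ := hW₁n
  obtain ⟨ε, hε, hball⟩ := Metric.isOpen_iff.mp hW₁o z hz
  -- on `W₁`: `6 m(t, x₂) W(x)⁻² = −1`
  have key : ∀ w ∈ W₁, 6 * m w.1 (w.2 2) * (stuartW w.2)⁻¹ ^ 2 = -1 := fun w hw => by
    have h := hcon w hw 0 (by decide)
    rw [fderiv_stuartProfile_e2_apply_zero, fderiv_stuartProfile_e0_apply_two] at h
    obtain ⟨hwt, hw0, hw2, hw2'⟩ := mem_stuartWindow (hW₁ hw)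
    have hK : cellAmp w.1 * Real.sin (w.2 2) * (Real.exp (w.2 0) - Real.exp (-(w.2 0))) ≠ 0 :=
      (mul_pos (mul_pos (cellAmp_pos hwt) (Real.sin_pos_of_pos_of_lt_pi hw2 hw2')) (exp_sub_exp_neg_pos hw0)).ne'
    have hr : (stuartW w.2)⁻¹ ≠ 0 := inv_ne_zero (stuartW_ne_zero w.2)
    have e1 : cellAmp w.1 * Real.sin (w.2 2) * (Real.exp (w.2 0) - Real.exp (-(w.2 0))) *
        ((stuartW w.2)⁻¹ * (-1 - 6 * m w.1 (w.2 2) * (stuartW w.2)⁻¹ ^ 2)) = 0 := by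
      linear_combination h
    have e2 := (mul_eq_zero.1 ((mul_eq_zero.1 e1).resolve_left hK)).resolve_left hr
    linarith
  have hmem : ((z.1, z.2 + (ε / 2) • (𝐞 0)) : ℝ × E3) ∈ W₁ := hball (by
    rw [Metric.mem_ball, Prod.dist_eq]
    have d1 : dist ((z.1, z.2 + (ε / 2) • (𝐞 0)) : ℝ × E3).1 z.1 = 0 := by simp
    have d2 : dist ((z.1, z.2 + (ε / 2) • (𝐞 0)) : ℝ × E3).2 z.2 = ε / 2 := by
      show dist (z.2 + (ε / 2) • (𝐞 0)) z.2 = ε / 2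
      rw [dist_eq_norm, add_sub_cancel_left, norm_smul, Real.norm_of_nonneg (half_pos hε).le]
      simp
    rw [d1, d2, max_eq_right (half_pos hε).le]
    exact half_lt_self hε)
  have h1 := key z hz
  have h2 := key _ hmem
  have e2 : ((z.1, z.2 + (ε / 2) • (𝐞 0)) : ℝ × E3).2 2 = z.2 2 := by simp
  have e1 : ((z.1, z.2 + (ε / 2) • (𝐞 0)) : ℝ × E3).1 = z.1 := rfl
  rw [e1, e2] at h2
  obtain ⟨-, hx0, -, -⟩ := mem_stuartWindow (hW₁ hz)
  -- `W` strictly increases along the segment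
  have hlt : stuartW z.2 < stuartW (z.2 + (ε / 2) • (𝐞 0)) := by
    have c0 : (z.2 + (ε / 2) • (𝐞 0) : E3) 0 = z.2 0 + ε / 2 := by simp
    have c1 : (z.2 + (ε / 2) • (𝐞 0) : E3) 1 = z.2 1 := by simp
    have hcosh : Real.cosh (z.2 0) < Real.cosh (z.2 0 + ε / 2) :=
      Real.cosh_lt_cosh.2 (by rw [abs_of_pos hx0, abs_of_pos (by linarith)]; linarith)
    rw [Real.cosh_eq, Real.cosh_eq] at hcosh
    show Real.exp (z.2 0) + Real.exp (-(z.2 0)) + Real.cos (z.2 1) <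
      Real.exp ((z.2 + (ε / 2) • (𝐞 0) : E3) 0) + Real.exp (-((z.2 + (ε / 2) • (𝐞 0) : E3) 0)) +
        Real.cos ((z.2 + (ε / 2) • (𝐞 0) : E3) 1)
    rw [c0, c1]
    linarith
  have hpos := stuartW_pos z.2
  have hM : m z.1 (z.2 2) ≠ 0 := by
    intro hM
    rw [hM] at h1
    linarith
  have hsq : (stuartW z.2)⁻¹ ^ 2 = (stuartW (z.2 + (ε / 2) • (𝐞 0)))⁻¹ ^ 2 :=
    mul_left_cancel₀ (mul_ne_zero (by norm_num) hM : (6 : ℝ) * m z.1 (z.2 2) ≠ 0) (by rw [h1, h2])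
  have hinv : (stuartW (z.2 + (ε / 2) • (𝐞 0)))⁻¹ < (stuartW z.2)⁻¹ := (inv_lt_inv₀ (hpos.trans hlt) hpos).2 hlt
  have hinv0 : 0 ≤ (stuartW (z.2 + (ε / 2) • (𝐞 0)))⁻¹ := inv_nonneg.2 (hpos.trans hlt).le
  have := pow_lt_pow_left₀ hinv hinv0 two_ne_zero
  rw [hsq] at this
  exact lt_irrefl _ this

end Summit.NavierStokesRegularity.NavierStokesRegularity.Theorems.PoloidalWindowRigidity.Negative

end
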